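import Summits.QuantumFields.YangMills.Theorems.AllWindowsColdBoxBoxHighLineTiltSupBoundsWilson
import Summits.QuantumFields.YangMills.Theorems.AllWindowsColdBoxBoxHighLinePlaquetteObsL2ByName
import Summits.QuantumFields.YangMills.Theorems.AllWindowsColdBoxBoxHighLinePlaquetteObsL4
import Summits.QuantumFields.YangMills.Theorems.AllWindowsColdBoxBoxHighLineEdgeChartHyper
import Summits.QuantumFields.YangMills.Theorems.AllWindowsColdBoxBoxHighLineCubicByName
import Summits.QuantumFields.YangMills.Theorems.AllWindowsColdBoxBoxHighLineGaussCovMainReduction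
import Summits.QuantumFields.YangMills.Theorems.AllWindowsColdBoxBoxHighLineTiltCumulantBounds
import Summits.QuantumFields.YangMills.Theorems.AllWindowsColdBoxBoxHighLineTiltTruncation

/-!
# T-S5.13K-G — the CONCRETE plaquette-cost sizes on the small-field box that feed `κ₃(0)` / `κ₄(t)` in ASSEMBLY-S5 §6 (e4)/(e5)
# (planner ym-idea-2 g18 20:30:55Z «13K cumulant sizes on D», LEAD sfw-p2 g77 20:53:17Z «GO — I hold no draft of (e4)/(e5) sizes»; consumed by
# w5's ✓`Tilt.abs_tiltCum4_muD_le` (p743619) and the LEAD's 13E; LINE-19 S5 ⟨stmt-QuantumFields-24004⟩/⟨24335⟩, LINE-20 U5 ⟨24336⟩)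

Width seat `ym-line-sfw-p2-w4` (prover-ym-line-sfw-p2-w4-g28-0).  For the plaquette cost `c = chartPlaqCost H x 1 2` at ANY base point `x`, centred at the Gaussian
mean of its quadratic part `a₁ := gaussAvg β H (linCurvSq H (plaq12At x)) = (3/2)β⁻¹K_p ∈ [0, 3/(2β)]` (✓`PlaqObsL4.gaussAvg_linCurvSq`, `K_p² ≤ 1`):

* (G1, sup on `D = smallField H s`, `0 ≤ s ≤ 1`) `TiltSup.linCurvSq_le` (`|ℓ_p|² ≤ 16s²`), `abs_chartPlaqCost_le` (`|c_p| ≤ 116s²`),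
  `gaussAvg_linCurvSq_plaq12At_nonneg/_le` (`0 ≤ a₁ ≤ 3/(2β)`), `abs_chartPlaqCost_sub_mean_le` (`|c − a₁| ≤ 116s² + 3/(2β)`);
* (G2, `L²`, full Gaussian, `H ≥ 1`, `β ≥ 1`) ★`gaussAvg_sq_chartPlaqCost_sub_mean_le`: `E₀[(c − a₁)²] ≤ C_G·(1+log H)²/β²`
  (`(c−a₁)² ≤ 3(|ℓ|²−a₁)² + 3(c^{odd})² + 3(c⁽⁴⁾)²`: LEAD's ✓`gaussAvg_centred_linCurvSq_sq_le` + ✓12d `plaquetteObsL2` clauses 2–3), and the restricted form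
  `gaussAvg_sfInd_mul_sq_chartPlaqCost_sub_mean_le` (`E₀[1_D(c−a₁)²] ≤` the same);
* (G3, the MIXED size for `κ₄`) ★★`gaussAvg_sfInd_mul_sq_mul_sq_le`: for every measurable `W` with `|W| ≤ B` and every constant `b`, with `V₃ = cubicVertex β H`,
  `E₀[1_D·(c−a₁)²·(W−b)²] ≤ 6·C₁₀(1+log H)^{m₁₀}H⁴/β³ + 3·10⁵·s⁶·C₁₂ₐ(1+log H)^{m₁₂ₐ}H⁴/β + 2·(116s² + 3/(2β))²·E₀[1_D·(W + V₃ − b)²]`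
  for `H ≥ 1`, `H⁴ ≤ β`, `0 ≤ s ≤ 1` — `(W−b)² ≤ 2V₃² + 2(W+V₃−b)²`; the `V₃`-half by ✓10 `cubicDecorrelation` on the `|ℓ|²`-part and the sup bounds
  ✓`TiltSup.abs_chartPlaqCostOdd_le`/`abs_chartPlaqCost_even_rem_le` (`100s³`, `200s³`) times ✓12a `cubicVariance` on the rest; the other half by `sup_D(c−a₁)²`;
  the last factor is fcl-p3's 13K-U quantity (`R((U+V₃−b)²)`), plugged in by the assembler BY NAME.

Everything proved; no definitions; standard axioms.  HONEST LABEL: support sizes for the OPEN assembly T-S5.13 of the XL stub S5 of a critic-PASSed DRAFT line;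
S5, U5, ⟨24004⟩ ⟨24335⟩ ⟨24336⟩ remain OPEN; no crux, rung or summit is proved; the Yang–Mills mass gap is NOT proved by this file. -/

set_option autoImplicit false

open MeasureTheory Real Finset Matrix
open Literature.Probability.LatticeModels (Site)
open Summit.QuantumFields.YangMills.Theorems.WeakCouplingRates (plaq12At)

namespace Summit.QuantumFields.YangMills.Theorems.AllWindowsColdBoxBoxHighLine

namespace TiltSup

variable {H : ℕ}

/-! ## (G1) Sup bounds on the small-field box -/

/-- `|ℓ_p(a)|² ≤ 16·s²` on `smallField H s` (`s ≥ 0`). -/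
theorem linCurvSq_le {s : ℝ} (hs0 : 0 ≤ s) {a : LandauFree H → E3} (ha : a ∈ smallField H s) (x : Site 4) (μ ν : Fin 4) :
    linCurvSq H (x, μ, ν) a ≤ 16 * s ^ 2 := by
  rw [WilsonSandwich.linCurvSq_eq_norm_sq]
  have h := (norm_plaqLin_le (plaqVar H x μ ν a)).trans (sum_norm_plaqVar_le hs0 ha x μ ν)
  calc ‖plaqLin (plaqVar H x μ ν a)‖ ^ 2 ≤ (4 * s) ^ 2 := pow_le_pow_left₀ (norm_nonneg _) h 2
    _ = 16 * s ^ 2 := by ring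

/-- `0 ≤ |ℓ_p(a)|²`. -/
theorem linCurvSq_nonneg' (p : Literature.MathematicalPhysics.QuantumFieldTheory.Plaq 4) (a : LandauFree H → E3) : 0 ≤ linCurvSq H p a :=
  Finset.sum_nonneg fun _ _ => sq_nonneg _

/-- **`|c_p(a)| ≤ 116·s²` on `smallField H s`, `0 ≤ s ≤ 1`** (`|ℓ_p|² ≤ 16s²` and ✓`abs_chartPlaqCost_sub_linCurvSq_le`: `|c − |ℓ|²| ≤ 100s³ ≤ 100s²`). -/
theorem abs_chartPlaqCost_le {s : ℝ} (hs0 : 0 ≤ s) (hs1 : s ≤ 1) {a : LandauFree H → E3} (ha : a ∈ smallField H s) (x : Site 4) (μ ν : Fin 4) :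
    |chartPlaqCost H x μ ν a| ≤ 116 * s ^ 2 := by
  have h1 := abs_chartPlaqCost_sub_linCurvSq_le hs0 hs1 ha x μ ν
  have h2 := linCurvSq_le hs0 ha x μ ν
  have h3 := linCurvSq_nonneg' (H := H) (x, μ, ν) a
  have hs32 : s ^ 3 ≤ s ^ 2 := pow_le_pow_of_le_one hs0 hs1 (by norm_num)
  rw [abs_le] at h1 ⊢
  constructor <;> nlinarith [h1.1, h1.2]

/-- `0 ≤ a₁ = E₀[|ℓ_{plaq12At x}|²]` (`β > 0`). -/
theorem gaussAvg_linCurvSq_plaq12At_nonneg {β : ℝ} (hβ : 0 < β) (x : Site 4) : 0 ≤ gaussAvg β H (linCurvSq H (plaq12At x)) :=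
  EdgeChartGaussian.gaussAvg_nonneg H hβ fun a => linCurvSq_nonneg' _ a

/-- **`a₁ = E₀[|ℓ_{plaq12At x}|²] ≤ 3/(2β)`** for `H ≥ 1`, `β > 0` (✓`PlaqObsL4.gaussAvg_linCurvSq`: `= (3/2)β⁻¹K_p`, ✓`hodgeKernel_plaq12At_sq_le_one`: `K_p² ≤ 1`). -/
theorem gaussAvg_linCurvSq_plaq12At_le (hH : 1 ≤ H) {β : ℝ} (hβ : 0 < β) (x : Site 4) :
    gaussAvg β H (linCurvSq H (plaq12At x)) ≤ 3 / (2 * β) := by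
  rw [PlaqObsL4.gaussAvg_linCurvSq H hβ]
  have hK := PlaqObsL4.hodgeKernel_plaq12At_sq_le_one H hH x
  have hK1 : landauCoeff H (plaq12At x) ⬝ᵥ ((hodgeQ H)⁻¹ *ᵥ landauCoeff H (plaq12At x)) ≤ 1 := by nlinarith
  calc 3 / 2 * β⁻¹ * (landauCoeff H (plaq12At x) ⬝ᵥ ((hodgeQ H)⁻¹ *ᵥ landauCoeff H (plaq12At x)))
      ≤ 3 / 2 * β⁻¹ * 1 := mul_le_mul_of_nonneg_left hK1 (by positivity)
    _ = 3 / (2 * β) := by field_simp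

/-- **`|c_p(a) − a₁| ≤ 116s² + 3/(2β)` on `smallField H s`** (`0 ≤ s ≤ 1`, `H ≥ 1`, `β > 0`; `p = plaq12At x`, i.e. `(x,1,2)`). -/
theorem abs_chartPlaqCost_sub_mean_le (hH : 1 ≤ H) {β s : ℝ} (hβ : 0 < β) (hs0 : 0 ≤ s) (hs1 : s ≤ 1)
    {a : LandauFree H → E3} (ha : a ∈ smallField H s) (x : Site 4) :
    |chartPlaqCost H x 1 2 a - gaussAvg β H (linCurvSq H (plaq12At x))| ≤ 116 * s ^ 2 + 3 / (2 * β) := by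
  have h1 := abs_chartPlaqCost_le hs0 hs1 ha x 1 2
  have h2 := gaussAvg_linCurvSq_plaq12At_le hH hβ x
  have h3 := gaussAvg_linCurvSq_plaq12At_nonneg (H := H) hβ x
  calc |chartPlaqCost H x 1 2 a - gaussAvg β H (linCurvSq H (plaq12At x))|
      ≤ |chartPlaqCost H x 1 2 a| + |gaussAvg β H (linCurvSq H (plaq12At x))| := abs_sub _ _
    _ ≤ 116 * s ^ 2 + 3 / (2 * β) := add_le_add h1 (by rwa [abs_of_nonneg h3])

/-! ## (G2) The `L²` size of the centred plaquette cost under the full Gaussian -/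

/-- `|c_p| ≤ 4` everywhere (`SU(2)`). -/
theorem abs_chartPlaqCost_le_four (x : Site 4) (μ ν : Fin 4) (a : LandauFree H → E3) : |chartPlaqCost H x μ ν a| ≤ 4 :=
  Summit.QuantumFields.YangMills.Theorems.WeakCouplingRates.abs_plaqCostAt_le x μ ν (edgeChart H a)

/-- ★ **`E₀[(c − a₁)²] ≤ C_G·(1 + log H)²/β²`** for `H ≥ 1`, `β ≥ 1`, every base point `x` (`c = chartPlaqCost H x 1 2`, `a₁ = E₀[|ℓ_{plaq12At x}|²]`):
`(c−a₁)² ≤ 3(|ℓ|²−a₁)² + 3(c^{odd})² + 3(c−|ℓ|²−c^{odd})²`, then LEAD's ✓`gaussAvg_centred_linCurvSq_sq_le` and ✓12d `plaquetteObsL2` clauses 2–3. -/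
theorem gaussAvg_sq_chartPlaqCost_sub_mean_le : ∃ C : ℝ, 0 ≤ C ∧ ∀ H : ℕ, 1 ≤ H → ∀ β : ℝ, 1 ≤ β → ∀ x : Site 4,
    gaussAvg β H (fun a => (chartPlaqCost H x 1 2 a - gaussAvg β H (linCurvSq H (plaq12At x))) ^ 2) ≤ C * (1 + Real.log H) ^ 2 / β ^ 2 := by
  obtain ⟨Cv, hCv0, hV⟩ := EdgeChartGaussian.gaussAvg_centred_linCurvSq_sq_le
  obtain ⟨C₁₂, h12⟩ := plaquetteObsL2
  have hC₁₂ : 0 ≤ C₁₂ := by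
    have h := (h12 1 le_rfl 1 le_rfl 0).2.1
    have h0 : 0 ≤ gaussAvg 1 1 (fun a => chartPlaqCostOdd 1 0 1 2 a ^ 2) := EdgeChartGaussian.gaussAvg_nonneg 1 one_pos fun a => sq_nonneg _
    have : (0 : ℝ) ≤ C₁₂ / 1 ^ 3 := h0.trans h
    simpa using this
  refine ⟨3 * Cv + 6 * C₁₂, by positivity, fun H hH β hβ x => ?_⟩
  have hβ0 : 0 < β := by linarith
  have hv := hV H hH β hβ0 (plaq12At x)
  have h2 := (h12 H hH β hβ x).2.1
  have h3 := (h12 H hH β hβ x).2.2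
  have hc4 : ∀ a : LandauFree H → E3, |chartPlaqCost H x 1 2 a| ≤ 4 := fun a => abs_chartPlaqCost_le_four (H := H) x 1 2 a
  have hco4 : ∀ a : LandauFree H → E3, |chartPlaqCostOdd H x 1 2 a| ≤ 4 := fun a => EdgeChartGaussian.abs_chartPlaqCostOdd_le H x 1 2 a
  have hmeas_c := EdgeChartGaussian.measurable_chartPlaqCost H x 1 2
  have hmeas_co := EdgeChartGaussian.measurable_chartPlaqCostOdd H x 1 2
  have hmeas_L := EdgeChartGaussian.measurable_linCurvSq H (plaq12At x)
  have hcertL := EdgeChartGaussian.polyCert_linCurvSq H (plaq12At x)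
  set m := gaussAvg β H (linCurvSq H (plaq12At x)) with hm
  set L := linCurvSq H (plaq12At x) with hL
  set c := chartPlaqCost H x 1 2 with hc
  set co := chartPlaqCostOdd H x 1 2 with hco
  -- integrability of the three dominating pieces
  have hIv : Integrable (fun a : LandauFree H → E3 => (L a - m) ^ 2 * gaussWeight β H a) :=
    EdgeChartGaussian.integrable_polyCert_mul_gaussWeight H hβ0
      (EdgeChartGaussian.polyCert_pow (EdgeChartGaussian.polyCert_sub hcertL (EdgeChartGaussian.polyCert_const m 2)) 2)
  have hIo : Integrable (fun a : LandauFree H → E3 => co a ^ 2 * gaussWeight β H a) :=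
    Tilt.integrable_bdd_mul_gaussWeight H hβ0 (C := 4 ^ 2) (hmeas_co.pow_const 2)
      fun a => by rw [abs_pow]; exact pow_le_pow_left₀ (abs_nonneg _) (hco4 a) 2
  have hI4 : Integrable (fun a : LandauFree H → E3 => (c a - L a - co a) ^ 2 * gaussWeight β H a) := by
    -- `(c − L − co)² ≤ 3c² + 3L² + 3co² ≤ 48 + 3L² + 48`
    refine EdgeChartGaussian.integrable_mul_gaussWeight_of_abs_le H hβ0 (((hmeas_c.sub hmeas_L).sub hmeas_co).pow_const 2)
      (G := fun a => 96 + 3 * L a ^ 2) ?_ fun a => ?_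
    · have hL2 : Integrable (fun a : LandauFree H → E3 => L a ^ 2 * gaussWeight β H a) :=
        EdgeChartGaussian.integrable_polyCert_mul_gaussWeight H hβ0 (EdgeChartGaussian.polyCert_pow hcertL 2)
      have := ((EdgeChartGaussian.integrable_gaussWeight H hβ0).const_mul 96).add (hL2.const_mul 3)
      exact this.congr (Filter.Eventually.of_forall fun a => by simp only [Pi.add_apply]; ring)
    · rw [abs_pow, sq_abs]
      have h1 := hc4 a
      have h2' := hco4 a
      rw [abs_le] at h1 h2'
      have hc2 : c a ^ 2 ≤ 16 := by nlinarith [h1.1, h1.2]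
      have hco2 : co a ^ 2 ≤ 16 := by nlinarith [h2'.1, h2'.2]
      nlinarith [sq_nonneg (c a + L a), sq_nonneg (co a - L a), sq_nonneg (c a + co a), hc2, hco2]
  -- pointwise domination and the three Gaussian sizes
  have hdom : ∀ a : LandauFree H → E3, (c a - m) ^ 2 ≤ 3 * (L a - m) ^ 2 + 3 * co a ^ 2 + 3 * (c a - L a - co a) ^ 2 := by
    intro a
    nlinarith [sq_nonneg ((L a - m) - co a), sq_nonneg ((L a - m) - (c a - L a - co a)), sq_nonneg (co a - (c a - L a - co a))]
  have hIsum : Integrable (fun a : LandauFree H → E3 => (3 * (L a - m) ^ 2 + 3 * co a ^ 2 + 3 * (c a - L a - co a) ^ 2) * gaussWeight β H a) := by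
    have := ((hIv.const_mul 3).add (hIo.const_mul 3)).add (hI4.const_mul 3)
    exact this.congr (Filter.Eventually.of_forall fun a => by simp only [Pi.add_apply]; ring)
  have hmono := EdgeChartGaussian.gaussAvg_mono_of_nonneg H hβ0 (fun a => sq_nonneg (c a - m)) hdom hIsum
  have hsplit : gaussAvg β H (fun a => 3 * (L a - m) ^ 2 + 3 * co a ^ 2 + 3 * (c a - L a - co a) ^ 2) =
      3 * gaussAvg β H (fun a => (L a - m) ^ 2) + 3 * gaussAvg β H (fun a => co a ^ 2) + 3 * gaussAvg β H (fun a => (c a - L a - co a) ^ 2) := by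
    have h13 : Integrable (fun a : LandauFree H → E3 => (3 * (L a - m) ^ 2 + 3 * co a ^ 2) * gaussWeight β H a) := by
      have := (hIv.const_mul 3).add (hIo.const_mul 3)
      exact this.congr (Filter.Eventually.of_forall fun a => by simp only [Pi.add_apply]; ring)
    have h3c : Integrable (fun a : LandauFree H → E3 => (3 * (c a - L a - co a) ^ 2) * gaussWeight β H a) := by
      have := hI4.const_mul 3; exact this.congr (Filter.Eventually.of_forall fun a => by ring)
    have h3v : Integrable (fun a : LandauFree H → E3 => (3 * (L a - m) ^ 2) * gaussWeight β H a) := by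
      have := hIv.const_mul 3; exact this.congr (Filter.Eventually.of_forall fun a => by ring)
    have h3o : Integrable (fun a : LandauFree H → E3 => (3 * co a ^ 2) * gaussWeight β H a) := by
      have := hIo.const_mul 3; exact this.congr (Filter.Eventually.of_forall fun a => by ring)
    rw [EdgeChartGaussian.gaussAvg_add β H h13 h3c, EdgeChartGaussian.gaussAvg_add β H h3v h3o,
      EdgeChartGaussian.gaussAvg_const_mul, EdgeChartGaussian.gaussAvg_const_mul, EdgeChartGaussian.gaussAvg_const_mul]
  have hL1 : 1 ≤ (1 + Real.log (H : ℝ)) ^ 2 := by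
    have : (1 : ℝ) ≤ H := by exact_mod_cast hH
    have := Real.log_nonneg this
    nlinarith
  have hβ2 : 0 < β ^ 2 := by positivity
  have hb3 : C₁₂ / β ^ 3 ≤ C₁₂ * (1 + Real.log H) ^ 2 / β ^ 2 := by
    rw [div_le_div_iff₀ (by positivity) hβ2]
    have : β ^ 2 ≤ β ^ 3 := pow_le_pow_right₀ hβ (by norm_num)
    nlinarith [mul_le_mul_of_nonneg_left this hC₁₂, mul_nonneg hC₁₂ (le_of_lt hβ2)]
  have hb4 : C₁₂ / β ^ 4 ≤ C₁₂ * (1 + Real.log H) ^ 2 / β ^ 2 := by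
    rw [div_le_div_iff₀ (by positivity) hβ2]
    have : β ^ 2 ≤ β ^ 4 := pow_le_pow_right₀ hβ (by norm_num)
    nlinarith [mul_le_mul_of_nonneg_left this hC₁₂, mul_nonneg hC₁₂ (le_of_lt hβ2)]
  refine hmono.trans ?_
  rw [hsplit]
  have e : (3 * Cv + 6 * C₁₂) * (1 + Real.log H) ^ 2 / β ^ 2 =
      3 * (Cv * (1 + Real.log H) ^ 2 / β ^ 2) + 3 * (C₁₂ * (1 + Real.log H) ^ 2 / β ^ 2) + 3 * (C₁₂ * (1 + Real.log H) ^ 2 / β ^ 2) := by ring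
  rw [e]
  exact add_le_add (add_le_add (by linarith) (by linarith)) (by linarith)

/-- The restricted form: `E₀[1_D·(c − a₁)²] ≤ E₀[(c − a₁)²] ≤ C_G(1+log H)²/β²` (`0 ≤ sfInd ≤ 1`). -/
theorem gaussAvg_sfInd_mul_sq_chartPlaqCost_sub_mean_le : ∃ C : ℝ, 0 ≤ C ∧ ∀ H : ℕ, 1 ≤ H → ∀ β : ℝ, 1 ≤ β → ∀ (s : ℝ) (x : Site 4),
    gaussAvg β H (fun a => sfInd H s a * (chartPlaqCost H x 1 2 a - gaussAvg β H (linCurvSq H (plaq12At x))) ^ 2) ≤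
      C * (1 + Real.log H) ^ 2 / β ^ 2 := by
  obtain ⟨C, hC0, hC⟩ := gaussAvg_sq_chartPlaqCost_sub_mean_le
  refine ⟨C, hC0, fun H hH β hβ s x => (le_trans ?_ (hC H hH β hβ x))⟩
  have hβ0 : 0 < β := by linarith
  set m := gaussAvg β H (linCurvSq H (plaq12At x))
  have hind : ∀ a : LandauFree H → E3, 0 ≤ sfInd H s a ∧ sfInd H s a ≤ 1 := fun a => by
    unfold sfInd Set.indicator; split_ifs <;> norm_num
  refine EdgeChartGaussian.gaussAvg_mono_of_nonneg H hβ0 (fun a => mul_nonneg (hind a).1 (sq_nonneg _))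
    (fun a => ?_) ?_
  · calc sfInd H s a * (chartPlaqCost H x 1 2 a - m) ^ 2 ≤ 1 * (chartPlaqCost H x 1 2 a - m) ^ 2 :=
        mul_le_mul_of_nonneg_right (hind a).2 (sq_nonneg _)
      _ = _ := one_mul _
  · -- bounded: `(c − m)² ≤ (4 + |m|)²`
    refine Tilt.integrable_bdd_mul_gaussWeight H hβ0 (C := (4 + |m|) ^ 2)
      (((EdgeChartGaussian.measurable_chartPlaqCost H x 1 2).sub measurable_const).pow_const 2) fun a => ?_
    rw [abs_pow, sq_abs] -- |(c-m)^2| = (c-m)^2 ... careful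
    have h1 := abs_chartPlaqCost_le_four (H := H) x 1 2 a
    have h2 : |chartPlaqCost H x 1 2 a - m| ≤ 4 + |m| := (abs_sub _ _).trans (add_le_add h1 le_rfl)
    calc (chartPlaqCost H x 1 2 a - m) ^ 2 = |chartPlaqCost H x 1 2 a - m| ^ 2 := (sq_abs _).symm
      _ ≤ (4 + |m|) ^ 2 := pow_le_pow_left₀ (abs_nonneg _) h2 2

/-! ## (G3) The mixed size `E₀[1_D·(c − a₁)²·(W − b)²]` for the fourth cumulant -/

/-- ★★ **The mixed size for `κ₄`.**  For `H ≥ 1`, `H⁴ ≤ β`, `0 ≤ s ≤ 1`, any base point `x`, any measurable `W` with `|W| ≤ B` and any constant `b`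
(`c = chartPlaqCost H x 1 2`, `a₁ = E₀[|ℓ_{plaq12At x}|²]`, `V₃ = cubicVertex β H`, `D = smallField H s`):
`E₀[1_D·(c−a₁)²·(W−b)²] ≤ C·(1+log H)^m·(H⁴/β³ + s⁶·H⁴/β) + 2·(116s² + 3/(2β))²·E₀[1_D·(W + V₃ − b)²]`
(`(W−b)² ≤ 2V₃² + 2(W+V₃−b)²`; on `D`: `(c−a₁)² ≤ 3(|ℓ|²−a₁)² + 3(100s³)² + 3(200s³)²` and `(c−a₁)² ≤ (116s²+3/(2β))²`;
✓10 `cubicDecorrelation`, ✓12a `cubicVariance`).  The last factor is the 13K-U quantity `E₀[1_D(U+V₃−b)²]` when `W` agrees with `tiltU` on `D`. -/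
theorem gaussAvg_sfInd_mul_sq_mul_sq_le : ∃ C : ℝ, ∃ m : ℕ, 0 ≤ C ∧ ∀ H : ℕ, 1 ≤ H → ∀ β : ℝ, (H : ℝ) ^ 4 ≤ β →
    ∀ s : ℝ, 0 ≤ s → s ≤ 1 → ∀ (x : Site 4) (W : (LandauFree H → E3) → ℝ) (B b : ℝ), Measurable W → (∀ a, |W a| ≤ B) →
      gaussAvg β H (fun a => sfInd H s a *
          ((chartPlaqCost H x 1 2 a - gaussAvg β H (linCurvSq H (plaq12At x))) ^ 2 * (W a - b) ^ 2)) ≤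
        C * (1 + Real.log H) ^ m * ((H : ℝ) ^ 4 / β ^ 3 + s ^ 6 * (H : ℝ) ^ 4 / β) +
          2 * (116 * s ^ 2 + 3 / (2 * β)) ^ 2 * gaussAvg β H (fun a => sfInd H s a * (W a + cubicVertex β H a - b) ^ 2) := by
  obtain ⟨C₁₀, m₁₀, h10⟩ := cubicDecorrelation
  obtain ⟨C₁₂, m₁₂, h12a⟩ := cubicVariance
  refine ⟨6 * max C₁₀ 0 + 300000 * max C₁₂ 0, max m₁₀ m₁₂, by positivity, fun H hH β hβ s hs0 hs1 x W B b hWm hWb => ?_⟩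
  have hH1 : (1 : ℝ) ≤ H := by exact_mod_cast hH
  have hβ1 : 1 ≤ β := le_trans (by nlinarith [one_le_pow₀ (M₀ := ℝ) hH1 (n := 4)]) hβ
  have hβ0 : 0 < β := by linarith
  have hL1 : 1 ≤ 1 + Real.log (H : ℝ) := by have := Real.log_nonneg hH1; linarith
  -- the two Gaussian inputs, before abbreviating
  have hdec := h10 H hH β hβ x
  have hvar := h12a H hH β hβ
  have hc4 : ∀ a : LandauFree H → E3, |chartPlaqCost H x 1 2 a| ≤ 4 := fun a => abs_chartPlaqCost_le_four (H := H) x 1 2 a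
  have hmeas_c := EdgeChartGaussian.measurable_chartPlaqCost H x 1 2
  have hmeas_L := EdgeChartGaussian.measurable_linCurvSq H (plaq12At x)
  have hcertL := EdgeChartGaussian.polyCert_linCurvSq H (plaq12At x)
  have hmeas_V := GaussNormalForm.measurable_cubicVertex β H
  have hsupD := fun (a : LandauFree H → E3) (ha : a ∈ smallField H s) => abs_chartPlaqCost_sub_mean_le hH hβ0 hs0 hs1 ha x
  have hodd := fun (a : LandauFree H → E3) (ha : a ∈ smallField H s) => abs_chartPlaqCostOdd_le hs0 hs1 ha x (1 : Fin 4) (2 : Fin 4)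
  have heven := fun (a : LandauFree H → E3) (ha : a ∈ smallField H s) => abs_chartPlaqCost_even_rem_le hs0 hs1 ha x (1 : Fin 4) (2 : Fin 4)
  -- a crude global bound on the cubic vertex: `|V₃| ≤ 4|β|·#plaquettesTouching`
  have hVb : ∀ a : LandauFree H → E3, |cubicVertex β H a| ≤
      4 * |β| * (Literature.MathematicalPhysics.QuantumLattice.plaquettesTouching
        (Literature.MathematicalPhysics.QuantumFieldTheory.AxialGauge.boxEdges 4 (2 * H + 1))).card := by
    intro a
    rw [cubicVertex, abs_mul]
    have h := Finset.abs_sum_le_sum_abs (fun p : Literature.MathematicalPhysics.QuantumLattice.ZdPlaquette 4 =>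
      chartPlaqCostOdd H p.1 p.2.1.1 p.2.1.2 a)
      (Literature.MathematicalPhysics.QuantumLattice.plaquettesTouching
        (Literature.MathematicalPhysics.QuantumFieldTheory.AxialGauge.boxEdges 4 (2 * H + 1)))
    have h' := h.trans (Finset.sum_le_sum fun p _ => EdgeChartGaussian.abs_chartPlaqCostOdd_le H p.1 p.2.1.1 p.2.1.2 a)
    rw [Finset.sum_const, nsmul_eq_mul] at h'
    calc |β| * |∑ p ∈ Literature.MathematicalPhysics.QuantumLattice.plaquettesTouching
          (Literature.MathematicalPhysics.QuantumFieldTheory.AxialGauge.boxEdges 4 (2 * H + 1)), chartPlaqCostOdd H p.1 p.2.1.1 p.2.1.2 a|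
        ≤ |β| * (_ * 4) := mul_le_mul_of_nonneg_left h' (abs_nonneg _)
      _ = _ := by ring
  set BV : ℝ := 4 * |β| * (Literature.MathematicalPhysics.QuantumLattice.plaquettesTouching
        (Literature.MathematicalPhysics.QuantumFieldTheory.AxialGauge.boxEdges 4 (2 * H + 1))).card with hBV
  have hBV0 : 0 ≤ BV := by positivity
  -- abbreviations
  set m₁ := gaussAvg β H (linCurvSq H (plaq12At x)) with hm₁
  set L := linCurvSq H (plaq12At x) with hL
  set c := chartPlaqCost H x 1 2 with hc
  set V := cubicVertex β H with hV
  set K : ℝ := 116 * s ^ 2 + 3 / (2 * β) with hK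
  have hK0 : 0 ≤ K := by positivity
  have hind1 : ∀ a : LandauFree H → E3, a ∈ smallField H s → sfInd H s a = 1 := fun a ha => by
    rw [sfInd, Set.indicator_of_mem ha]
  have hind0 : ∀ a : LandauFree H → E3, a ∉ smallField H s → sfInd H s a = 0 := fun a ha => by
    rw [sfInd, Set.indicator_of_notMem ha]
  have h01 : ∀ a : LandauFree H → E3, 0 ≤ sfInd H s a ∧ sfInd H s a ≤ 1 := fun a => by
    by_cases ha : a ∈ smallField H s
    · rw [hind1 a ha]; norm_num
    · rw [hind0 a ha]; norm_num
  have hmeas_sf : Measurable (sfInd H s) := by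
    have : sfInd H s = (smallField H s).indicator fun _ => (1 : ℝ) := rfl
    rw [this]; exact measurable_const.indicator (ChartGauss.measurableSet_smallField s)
  -- pointwise domination
  have hdom : ∀ a : LandauFree H → E3,
      sfInd H s a * ((c a - m₁) ^ 2 * (W a - b) ^ 2) ≤
        6 * ((L a - m₁) ^ 2 * V a ^ 2) + 300000 * s ^ 6 * V a ^ 2 + 2 * K ^ 2 * (sfInd H s a * (W a + V a - b) ^ 2) := by
    intro a
    by_cases ha : a ∈ smallField H s
    · rw [hind1 a ha, one_mul, one_mul]
      have h1 : (W a - b) ^ 2 ≤ 2 * V a ^ 2 + 2 * (W a + V a - b) ^ 2 := by nlinarith [sq_nonneg (W a + V a - b + V a)]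
      have hco := hodd a ha
      have hc4' := heven a ha
      have h2 : (c a - m₁) ^ 2 ≤ 3 * (L a - m₁) ^ 2 + 150000 * s ^ 6 := by
        have e : c a - m₁ = (L a - m₁) + chartPlaqCostOdd H x 1 2 a + (c a - L a - chartPlaqCostOdd H x 1 2 a) := by ring
        have h3 : (c a - m₁) ^ 2 ≤ 3 * (L a - m₁) ^ 2 + 3 * chartPlaqCostOdd H x 1 2 a ^ 2 + 3 * (c a - L a - chartPlaqCostOdd H x 1 2 a) ^ 2 := by
          rw [e]; nlinarith [sq_nonneg ((L a - m₁) - chartPlaqCostOdd H x 1 2 a),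
            sq_nonneg ((L a - m₁) - (c a - L a - chartPlaqCostOdd H x 1 2 a)),
            sq_nonneg (chartPlaqCostOdd H x 1 2 a - (c a - L a - chartPlaqCostOdd H x 1 2 a))]
        have ho2 : chartPlaqCostOdd H x 1 2 a ^ 2 ≤ (100 * s ^ 3) ^ 2 := by
          rw [← sq_abs]; exact pow_le_pow_left₀ (abs_nonneg _) hco 2
        have he2 : (c a - L a - chartPlaqCostOdd H x 1 2 a) ^ 2 ≤ (200 * s ^ 3) ^ 2 := by
          rw [← sq_abs]; exact pow_le_pow_left₀ (abs_nonneg _) hc4' 2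
        nlinarith
      have h3 : (c a - m₁) ^ 2 ≤ K ^ 2 := by
        rw [← sq_abs]; exact pow_le_pow_left₀ (abs_nonneg _) (hsupD a ha) 2
      have hA : (c a - m₁) ^ 2 * (2 * V a ^ 2) ≤ (3 * (L a - m₁) ^ 2 + 150000 * s ^ 6) * (2 * V a ^ 2) :=
        mul_le_mul_of_nonneg_right h2 (by positivity)
      have hB : (c a - m₁) ^ 2 * (2 * (W a + V a - b) ^ 2) ≤ K ^ 2 * (2 * (W a + V a - b) ^ 2) :=
        mul_le_mul_of_nonneg_right h3 (by positivity)
      have h0 : 0 ≤ (c a - m₁) ^ 2 := sq_nonneg _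
      calc (c a - m₁) ^ 2 * (W a - b) ^ 2 ≤ (c a - m₁) ^ 2 * (2 * V a ^ 2 + 2 * (W a + V a - b) ^ 2) :=
            mul_le_mul_of_nonneg_left h1 h0
        _ = (c a - m₁) ^ 2 * (2 * V a ^ 2) + (c a - m₁) ^ 2 * (2 * (W a + V a - b) ^ 2) := by ring
        _ ≤ (3 * (L a - m₁) ^ 2 + 150000 * s ^ 6) * (2 * V a ^ 2) + K ^ 2 * (2 * (W a + V a - b) ^ 2) := add_le_add hA hB
        _ = 6 * ((L a - m₁) ^ 2 * V a ^ 2) + 300000 * s ^ 6 * V a ^ 2 + 2 * K ^ 2 * (W a + V a - b) ^ 2 := by ring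
    · rw [hind0 a ha, zero_mul, zero_mul, mul_zero, add_zero]
      positivity
  -- integrability of the three dominating pieces
  have hI1 : Integrable (fun a : LandauFree H → E3 => (L a - m₁) ^ 2 * V a ^ 2 * gaussWeight β H a) := by
    refine EdgeChartGaussian.integrable_mul_gaussWeight_of_abs_le H hβ0 (((hmeas_L.sub measurable_const).pow_const 2).mul (hmeas_V.pow_const 2))
      (G := fun a => BV ^ 2 * (L a - m₁) ^ 2) ?_ fun a => ?_
    · have := (EdgeChartGaussian.integrable_polyCert_mul_gaussWeight H hβ0
        (EdgeChartGaussian.polyCert_pow (EdgeChartGaussian.polyCert_sub hcertL (EdgeChartGaussian.polyCert_const m₁ 2)) 2)).const_mul (BV ^ 2)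
      exact this.congr (Filter.Eventually.of_forall fun a => by ring)
    · rw [abs_mul, abs_pow, abs_pow, sq_abs, sq_abs]
      have hv2 : V a ^ 2 ≤ BV ^ 2 := by rw [← sq_abs]; exact pow_le_pow_left₀ (abs_nonneg _) (hVb a) 2
      nlinarith [sq_nonneg (L a - m₁)]
  have hI2 : Integrable (fun a : LandauFree H → E3 => V a ^ 2 * gaussWeight β H a) :=
    Tilt.integrable_bdd_mul_gaussWeight H hβ0 (C := BV ^ 2) (hmeas_V.pow_const 2)
      fun a => by rw [abs_pow]; exact pow_le_pow_left₀ (abs_nonneg _) (hVb a) 2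
  have hI3 : Integrable (fun a : LandauFree H → E3 => sfInd H s a * (W a + V a - b) ^ 2 * gaussWeight β H a) := by
    refine Tilt.integrable_bdd_mul_gaussWeight H hβ0 (C := (B + BV + |b|) ^ 2)
      (hmeas_sf.mul (((hWm.add hmeas_V).sub measurable_const).pow_const 2)) fun a => ?_
    rw [abs_mul, abs_of_nonneg (h01 a).1, abs_pow, sq_abs]
    have hw : |W a + V a - b| ≤ B + BV + |b| :=
      (abs_sub _ _).trans (add_le_add ((abs_add_le _ _).trans (add_le_add (hWb a) (hVb a))) le_rfl)
    have hsq : (W a + V a - b) ^ 2 ≤ (B + BV + |b|) ^ 2 := by rw [← sq_abs]; exact pow_le_pow_left₀ (abs_nonneg _) hw 2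
    calc sfInd H s a * (W a + V a - b) ^ 2 ≤ 1 * (B + BV + |b|) ^ 2 := mul_le_mul (h01 a).2 hsq (sq_nonneg _) zero_le_one
      _ = _ := one_mul _
  have hI1' : Integrable (fun a : LandauFree H → E3 => 6 * ((L a - m₁) ^ 2 * V a ^ 2) * gaussWeight β H a) := by
    have := hI1.const_mul 6; exact this.congr (Filter.Eventually.of_forall fun a => by ring)
  have hI2' : Integrable (fun a : LandauFree H → E3 => 300000 * s ^ 6 * V a ^ 2 * gaussWeight β H a) := by
    have := hI2.const_mul (300000 * s ^ 6); exact this.congr (Filter.Eventually.of_forall fun a => by ring)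
  have hI3' : Integrable (fun a : LandauFree H → E3 => 2 * K ^ 2 * (sfInd H s a * (W a + V a - b) ^ 2) * gaussWeight β H a) := by
    have := hI3.const_mul (2 * K ^ 2); exact this.congr (Filter.Eventually.of_forall fun a => by ring)
  have hI12 : Integrable (fun a : LandauFree H → E3 =>
      (6 * ((L a - m₁) ^ 2 * V a ^ 2) + 300000 * s ^ 6 * V a ^ 2) * gaussWeight β H a) := by
    have := hI1'.add hI2'; exact this.congr (Filter.Eventually.of_forall fun a => by simp only [Pi.add_apply]; ring)
  have hIG : Integrable (fun a : LandauFree H → E3 =>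
      (6 * ((L a - m₁) ^ 2 * V a ^ 2) + 300000 * s ^ 6 * V a ^ 2 + 2 * K ^ 2 * (sfInd H s a * (W a + V a - b) ^ 2)) * gaussWeight β H a) := by
    have := hI12.add hI3'; exact this.congr (Filter.Eventually.of_forall fun a => by simp only [Pi.add_apply]; ring)
  -- monotonicity and linearity
  have hmono := EdgeChartGaussian.gaussAvg_mono_of_nonneg H hβ0
    (fun a => mul_nonneg (h01 a).1 (mul_nonneg (sq_nonneg _) (sq_nonneg _))) hdom hIG
  have hsplit : gaussAvg β H (fun a => 6 * ((L a - m₁) ^ 2 * V a ^ 2) + 300000 * s ^ 6 * V a ^ 2 +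
        2 * K ^ 2 * (sfInd H s a * (W a + V a - b) ^ 2)) =
      6 * gaussAvg β H (fun a => (L a - m₁) ^ 2 * V a ^ 2) + 300000 * s ^ 6 * gaussAvg β H (fun a => V a ^ 2) +
        2 * K ^ 2 * gaussAvg β H (fun a => sfInd H s a * (W a + V a - b) ^ 2) := by
    rw [EdgeChartGaussian.gaussAvg_add β H hI12 hI3', EdgeChartGaussian.gaussAvg_add β H hI1' hI2',
      EdgeChartGaussian.gaussAvg_const_mul, EdgeChartGaussian.gaussAvg_const_mul, EdgeChartGaussian.gaussAvg_const_mul]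
  refine hmono.trans ?_
  rw [hsplit]
  -- sizes of the two Gaussian terms
  have hX3 : 0 ≤ (H : ℝ) ^ 4 / β ^ 3 := by positivity
  have hX1 : 0 ≤ (H : ℝ) ^ 4 / β := by positivity
  have hLm10 : (1 + Real.log (H : ℝ)) ^ m₁₀ ≤ (1 + Real.log (H : ℝ)) ^ max m₁₀ m₁₂ := pow_le_pow_right₀ hL1 (le_max_left _ _)
  have hLm12 : (1 + Real.log (H : ℝ)) ^ m₁₂ ≤ (1 + Real.log (H : ℝ)) ^ max m₁₀ m₁₂ := pow_le_pow_right₀ hL1 (le_max_right _ _)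
  have hdec' : gaussAvg β H (fun a => (L a - m₁) ^ 2 * V a ^ 2) ≤ max C₁₀ 0 * (1 + Real.log H) ^ max m₁₀ m₁₂ * ((H : ℝ) ^ 4 / β ^ 3) := by
    refine hdec.trans ?_
    calc C₁₀ * (1 + Real.log H) ^ m₁₀ * (H : ℝ) ^ 4 / β ^ 3 = C₁₀ * ((1 + Real.log H) ^ m₁₀ * ((H : ℝ) ^ 4 / β ^ 3)) := by ring
      _ ≤ max C₁₀ 0 * ((1 + Real.log H) ^ m₁₀ * ((H : ℝ) ^ 4 / β ^ 3)) :=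
          mul_le_mul_of_nonneg_right (le_max_left _ _) (by positivity)
      _ ≤ max C₁₀ 0 * ((1 + Real.log H) ^ max m₁₀ m₁₂ * ((H : ℝ) ^ 4 / β ^ 3)) :=
          mul_le_mul_of_nonneg_left (mul_le_mul_of_nonneg_right hLm10 hX3) (le_max_right _ _)
      _ = _ := by ring
  have hvar' : gaussAvg β H (fun a => V a ^ 2) ≤ max C₁₂ 0 * (1 + Real.log H) ^ max m₁₀ m₁₂ * ((H : ℝ) ^ 4 / β) := by
    refine hvar.trans ?_
    calc C₁₂ * (H : ℝ) ^ 4 * (1 + Real.log H) ^ m₁₂ / β = C₁₂ * ((1 + Real.log H) ^ m₁₂ * ((H : ℝ) ^ 4 / β)) := by ring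
      _ ≤ max C₁₂ 0 * ((1 + Real.log H) ^ m₁₂ * ((H : ℝ) ^ 4 / β)) :=
          mul_le_mul_of_nonneg_right (le_max_left _ _) (by positivity)
      _ ≤ max C₁₂ 0 * ((1 + Real.log H) ^ max m₁₀ m₁₂ * ((H : ℝ) ^ 4 / β)) :=
          mul_le_mul_of_nonneg_left (mul_le_mul_of_nonneg_right hLm12 hX1) (le_max_right _ _)
      _ = _ := by ring
  have hs6 : 0 ≤ s ^ 6 := by positivity
  have hT2 : 300000 * s ^ 6 * gaussAvg β H (fun a => V a ^ 2) ≤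
      300000 * s ^ 6 * (max C₁₂ 0 * (1 + Real.log H) ^ max m₁₀ m₁₂ * ((H : ℝ) ^ 4 / β)) :=
    mul_le_mul_of_nonneg_left hvar' (by positivity)
  have hT1 : 6 * gaussAvg β H (fun a => (L a - m₁) ^ 2 * V a ^ 2) ≤ 6 * (max C₁₀ 0 * (1 + Real.log H) ^ max m₁₀ m₁₂ * ((H : ℝ) ^ 4 / β ^ 3)) :=
    mul_le_mul_of_nonneg_left hdec' (by norm_num)
  have e : (6 * max C₁₀ 0 + 300000 * max C₁₂ 0) * (1 + Real.log H) ^ max m₁₀ m₁₂ * ((H : ℝ) ^ 4 / β ^ 3 + s ^ 6 * (H : ℝ) ^ 4 / β) =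
      6 * (max C₁₀ 0 * (1 + Real.log H) ^ max m₁₀ m₁₂ * ((H : ℝ) ^ 4 / β ^ 3)) +
        300000 * s ^ 6 * (max C₁₂ 0 * (1 + Real.log H) ^ max m₁₀ m₁₂ * ((H : ℝ) ^ 4 / β)) +
      (6 * max C₁₀ 0 * (1 + Real.log H) ^ max m₁₀ m₁₂ * (s ^ 6 * (H : ℝ) ^ 4 / β) +
        300000 * max C₁₂ 0 * (1 + Real.log H) ^ max m₁₀ m₁₂ * ((H : ℝ) ^ 4 / β ^ 3)) := by ring
  have hextra : 0 ≤ 6 * max C₁₀ 0 * (1 + Real.log H) ^ max m₁₀ m₁₂ * (s ^ 6 * (H : ℝ) ^ 4 / β) +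
      300000 * max C₁₂ 0 * (1 + Real.log H) ^ max m₁₀ m₁₂ * ((H : ℝ) ^ 4 / β ^ 3) := by positivity
  rw [e]
  linarith

end TiltSup

end Summit.QuantumFields.YangMills.Theorems.AllWindowsColdBoxBoxHighLine
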